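import Summits.BirchSwinnertonDyer.BirchSwinnertonDyer.Theorems.PrintX11aHardLocusRecordsDoor
import HarnessLib

/-!
# Route `PrintX11a` (cell `bsd-print-x11a`, seat p2 — PLAN v6 §2 / v6.3 RULING 1, owner of `Part2`): the five
# Teichmüller cosets of the `Part2` μ-witnesses as KERNEL-DECIDED finsets (`--supports stmt-BirchSwinnertonDyer-20614`;
# consumed by `PrintX11aHardLocusRecordsFive3–7.lean`)

Theorems only; no definition, no named fact, no `sorry`; nothing about any curve. p3's Teichmüller-coset door
`X11a.muAnZeroAt_of_cosetTable` (`Theorems/PrintX11aMuCosetDoor.lean`, p557151) takes the coset of a μ-witness as a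
finset `S ⊂ ℤ/p^(n+1)` with the membership certificate `b ∈ S ↔ b^(p−1) = (1+p)^((p−1)·s₀)` (`hS`). The 15 records of
ty3's `RecordsLeafNonSurjMuPart2.lean` (p550786) at `p = 5` use exactly five cosets `u·μ₄`: level `2` with `u = 1`
(`{1, 7, 18, 24}`, `s₀ = 0`) and `u = 11` (`{2, 11, 14, 23}`, `s₀ = 2`: `11⁴ = 6⁸` in `ℤ/25`), level `3` with `u = 1`
(`{1, 57, 68, 124}`, `s₀ = 0`), `u = 6` (`{6, 33, 92, 119}`, `s₀ = 1`) and `u = 16` (`{16, 37, 88, 109}`, `s₀ = 13`: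
`16⁴ = 6⁵²` in `ℤ/125`). Each certificate is decided by the kernel here ONCE, as a closed statement (the record files
cannot run `decide` under their local `Fact (Nat.Prime 5)` instance), and cited by name per record.
beyond-print theorem: NO. References: [MazurTateTeitelbaum1986Invent] §I.13 (Teichmüller classes); [Washington1997]
§5.1; cell files `Theorems/PrintX11aMuCosetDoor.lean` (p3), `Theorems/PrintX11aMuCosetCertificate.lean` §2.
-/

set_option linter.dupNamespace false -- the directory name repeats the summit name (sibling precedent)

set_option autoImplicit false

noncomputable section

open scoped Classical MatrixGroups ModularForm

open WeierstrassCurve Literature.NumberTheory.EllipticCurves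
  Literature.NumberTheory.EllipticCurves.ModularForms
  Literature.NumberTheory.EllipticCurves.Rank1Residual
  Literature.NumberTheory.EllipticCurves.Rank1Residual.Typed
  Literature.NumberTheory.EllipticCurves.Rank1Residual.X11RankOneCertificates
  Literature.NumberTheory.EllipticCurves.Wuthrich2014
  Literature.NumberTheory.EllipticCurves.SteinWuthrich2013
  Literature.NumberTheory.EllipticCurves.Greenberg1999
  Literature.NumberTheory.EllipticCurves.Kato2004
  Summit.BirchSwinnertonDyer.BirchSwinnertonDyer.Rank1Residual.IntModel
  Summit.BirchSwinnertonDyer.Rank1Residual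
  Summit.BirchSwinnertonDyer.Rank1Residual.Supersingular
  Summit.BirchSwinnertonDyer.Rank1Residual.X11b

namespace Summit.BirchSwinnertonDyer.BirchSwinnertonDyer.Theorems.HardLocusRecords

/-- The Teichmüller coset `μ₄ ⊂ (ℤ/25)ˣ` (witness level `2`, `u = 1`, `s₀ = 0`): `{1, 7, 18, 24} = {b : b⁴ = 6⁰}`.
[cite: MazurTateTeitelbaum1986Invent, §I.13] -/
theorem coset_five_sq_zero : ∀ b : ZMod 25, b ∈ ({1, 7, 18, 24} : Finset (ZMod 25)) ↔
    b ^ (5 - 1) = ((1 + 5 : ℕ) : ZMod 25) ^ ((5 - 1) * (0 : ZMod 5).val) := by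
  decide +kernel

/-- The Teichmüller coset `11·μ₄ ⊂ (ℤ/25)ˣ` (witness level `2`, `u = 11`, `s₀ = 2`): `{2, 11, 14, 23} = {b : b⁴ = 6⁸}`.
[cite: MazurTateTeitelbaum1986Invent, §I.13] -/
theorem coset_five_sq_two : ∀ b : ZMod 25, b ∈ ({2, 11, 14, 23} : Finset (ZMod 25)) ↔
    b ^ (5 - 1) = ((1 + 5 : ℕ) : ZMod 25) ^ ((5 - 1) * (2 : ZMod 5).val) := by
  decide +kernel

/-- The Teichmüller coset `μ₄ ⊂ (ℤ/125)ˣ` (witness level `3`, `u = 1`, `s₀ = 0`): `{1, 57, 68, 124} = {b : b⁴ = 6⁰}`.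
[cite: MazurTateTeitelbaum1986Invent, §I.13] -/
theorem coset_five_cube_zero : ∀ b : ZMod 125, b ∈ ({1, 57, 68, 124} : Finset (ZMod 125)) ↔
    b ^ (5 - 1) = ((1 + 5 : ℕ) : ZMod 125) ^ ((5 - 1) * (0 : ZMod 25).val) := by
  decide +kernel

/-- The Teichmüller coset `6·μ₄ ⊂ (ℤ/125)ˣ` (witness level `3`, `u = 6`, `s₀ = 1`): `{6, 33, 92, 119} = {b : b⁴ = 6⁴}`.
[cite: MazurTateTeitelbaum1986Invent, §I.13] -/
theorem coset_five_cube_one : ∀ b : ZMod 125, b ∈ ({6, 33, 92, 119} : Finset (ZMod 125)) ↔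
    b ^ (5 - 1) = ((1 + 5 : ℕ) : ZMod 125) ^ ((5 - 1) * (1 : ZMod 25).val) := by
  decide +kernel

/-- The Teichmüller coset `16·μ₄ ⊂ (ℤ/125)ˣ` (witness level `3`, `u = 16`, `s₀ = 13`): `{16, 37, 88, 109} = {b : b⁴ = 6⁵²}`.
[cite: MazurTateTeitelbaum1986Invent, §I.13] -/
theorem coset_five_cube_thirteen : ∀ b : ZMod 125, b ∈ ({16, 37, 88, 109} : Finset (ZMod 125)) ↔
    b ^ (5 - 1) = ((1 + 5 : ℕ) : ZMod 125) ^ ((5 - 1) * (13 : ZMod 25).val) := by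
  decide +kernel

end Summit.BirchSwinnertonDyer.BirchSwinnertonDyer.Theorems.HardLocusRecords

end
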